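import Mathlib
import Summits.NavierStokesRegularity.NavierStokesRegularity.Theorems.EulerZoomLiouvillePowerGaugeEulerLiouvilleHoopFrameRadial
import Summits.NavierStokesRegularity.NavierStokesRegularity.Theorems.EulerZoomLiouvillePowerGaugeEulerLiouvilleHoopCircleAvgCalculus

/-!
# Hoop core — K-AXIS AX-2: the circle-averaged radial law (general centre)

Sub-problem `NavierStokesRegularity`, crux `PowerGaugeEulerLiouville` (a crux CLASS of self-similar Euler/NS strata — not NS
regularity; nothing here is specific to the class: these are identities for ANY `C²` solution of the self-similar Euler
profile system `(1−γ)V + DV[γ(y−c) + V] + ∇P = 0`, `div V = 0`, `Literature.Analysis.FluidPDE.IsSelfSimilarEulerProfile γ c V P`).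

Along the circle `θ ↦ axisPt s t θ` of radius `t > 0` at height `s` around the `e_z`-axis, write `V_r, V_θ, V_z` for the frame
components, `a_ij = ⟪DV(y) ê_i, ê_j⟫` for the frame entries of `DV`, `c_r = ⟪c, ê_r⟫`, `c_θ = ⟪c, ê_θ⟫`.

* `profile_eq_radial_frame` — the radial component of the profile equation with a general centre `c`:
  `⟪∇P, ê_r⟫ + (1−γ)V_r + (γt − γc_r + V_r) a_rr + (V_θ − γc_θ) a_θr + (γ(s − c₂) + V_z) a_zr = 0`.
* `frame_trace_eq_zero` — incompressibility in the frame: `a_rr + a_θθ + a_zz = 0`.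
* `radialLaw_pointwise` — the CONSERVATIVE form at each circle point:
  `⟪∇P, ê_r⟫ + (1−3γ)V_r + D[(γr + V_r)V_r](y)[ê_r] + D[(γ(y₂−c₂) + V_z)V_r](y)[e_z] − γ·D[−c_r V_z](y)[e_z]`
  `+ (a_θθ V_r + a_θr V_θ) + γ(c_r a_θθ − c_θ a_θr) = 0`,
  where the last two groups are `(1/t)·(∂_θ[V_θ V_r + γ(c_r V_θ − c_θ V_r)] + V_r² − V_θ²)` (`hasDerivAt_thetaBracket`).
* `radialLaw_circleAvg` — **AX-2**: averaging over the circle kills the `θ`-derivative (periodicity), leaving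
  `circleAvg (⟪∇P, ê_r⟫ + (1−3γ)V_r + D[(γr+V_r)V_r][ê_r] + D[(γ(y₂−c₂)+V_z)V_r][e_z] − γ D[−c_r V_z][e_z] + (V_r²−V_θ²)/r) s t = 0`.
  The three `D[…]` integrands are literally those of `endTermC` (via `endTerm`-type products), `offsetTerm` and the boundary
  term of `AxisLawCentre` (`…HoopDefs`), so AX-3 (integration in `t`, axis atom `½(‖V‖² − V_z²)`) and AX-4 (FTC in `s`) are
  calculus on top of this file and `…HoopCircleAvgCalculus`.
* `hasDerivAt_circleAvg_pressure_radius` — `∂_t circleAvg P s t = circleAvg ⟪∇P, ê_r⟫ s t` (`P ∈ C¹`, `t > 0`).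
-/

noncomputable section

set_option linter.dupNamespace false

open Set Function WithLp Metric Filter Topology MeasureTheory intervalIntegral
open scoped InnerProductSpace RealInnerProductSpace

namespace Summit.NavierStokesRegularity.NavierStokesRegularity.Theorems.PowerGaugeEulerLiouville.HoopCore

open Literature.Analysis Literature.Analysis.FluidPDE

/-! ### The circle is `2π`-periodic; the frame on it -/

/-- `axisPt s t (θ + 2π) = axisPt s t θ`. [folklore] -/
theorem axisPt_add_two_pi (s t θ : ℝ) : axisPt s t (θ + 2 * Real.pi) = axisPt s t θ := by
  rw [axisPt_eq, axisPt_eq, Real.cos_add_two_pi, Real.sin_add_two_pi]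

/-- Orthonormality of the frame `(ê_r, ê_θ, e_z)` at a circle point (`t > 0`). [folklore] -/
theorem frame_orthonormal_axisPt (s : ℝ) {t : ℝ} (ht : 0 < t) (θ : ℝ) :
    ⟪eR (axisPt s t θ), eR (axisPt s t θ)⟫ = 1 ∧ ⟪eTheta (axisPt s t θ), eTheta (axisPt s t θ)⟫ = 1 ∧
      ⟪eR (axisPt s t θ), eTheta (axisPt s t θ)⟫ = 0 ∧ ⟪eZ, eR (axisPt s t θ)⟫ = 0 ∧
      ⟪eZ, eTheta (axisPt s t θ)⟫ = 0 ∧ ⟪(eZ : EuclideanSpace ℝ (Fin 3)), eZ⟫ = 1 := by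
  rw [eR_axisPt s ht, eTheta_axisPt s ht, eZ_eq_rotZ θ]
  simp only [← rotZLIE_apply, LinearIsometryEquiv.inner_map_map]
  simp [EuclideanSpace.inner_single_left]

/-- Frame expansion of a vector at a circle point: `w = ⟪w, ê_r⟫ ê_r + ⟪w, ê_θ⟫ ê_θ + ⟪w, e_z⟫ e_z` (`t > 0`). [folklore] -/
theorem frame_expand_axisPt (s : ℝ) {t : ℝ} (ht : 0 < t) (θ : ℝ) (w : EuclideanSpace ℝ (Fin 3)) :
    w = ⟪w, eR (axisPt s t θ)⟫ • eR (axisPt s t θ) + ⟪w, eTheta (axisPt s t θ)⟫ • eTheta (axisPt s t θ) + ⟪w, eZ⟫ • eZ := by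
  have hy : cylRadius (axisPt s t θ) ≠ 0 := by rw [cylRadius_axisPt s ht.le θ]; exact ht.ne'
  have h1 : w = toLp 2 ![w 0, w 1, 0] + (w 2) • eZ := by
    ext i; fin_cases i <;> simp [eZ]
  have h2 : ⟪w, eZ⟫ = w 2 := by simp [eZ, EuclideanSpace.inner_single_right]
  rw [h2]
  conv_lhs => rw [h1, horizontal_eq_frame hy w]

/-- `⟪c, ê_r(y)⟫ = c₀ ê_r(y)₀ + c₁ ê_r(y)₁` (the third component of `ê_r` vanishes) — the integrand of `offsetTerm`. [folklore] -/
theorem inner_eR_eq_components (c y : EuclideanSpace ℝ (Fin 3)) : ⟪c, eR y⟫ = c 0 * eR y 0 + c 1 * eR y 1 := by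
  have h2 : eR y 2 = 0 := by simp [eR]
  simp only [PiLp.inner_apply, Fin.sum_univ_three, RCLike.inner_apply, conj_trivial, h2]
  ring

/-- `V_r` is differentiable off the axis where `V` is. [folklore] -/
theorem differentiableAt_radialVelocity {V : EuclideanSpace ℝ (Fin 3) → EuclideanSpace ℝ (Fin 3)} {y : EuclideanSpace ℝ (Fin 3)}
    (hy : cylRadius y ≠ 0) (hV : DifferentiableAt ℝ V y) : DifferentiableAt ℝ (radialVelocity V) y :=
  hV.inner ℝ (differentiableAt_eR hy)

/-- `V_z` is differentiable where `V` is. [folklore] -/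
theorem differentiableAt_axialVelocity {V : EuclideanSpace ℝ (Fin 3) → EuclideanSpace ℝ (Fin 3)} {y : EuclideanSpace ℝ (Fin 3)}
    (hV : DifferentiableAt ℝ V y) : DifferentiableAt ℝ (axialVelocity V) y := by
  have e : axialVelocity V = fun y => ⟪V y, eZ⟫ := by
    funext y; simp [axialVelocity, eZ, EuclideanSpace.inner_single_right]
  rw [e]
  exact hV.inner ℝ (differentiableAt_const _)

/-! ### The radial profile equation with a general centre, and incompressibility, in the frame -/

/-- **RADIAL PROFILE EQUATION IN THE FRAME (general centre `c`)**: at `y = axisPt s t θ`, `t > 0`,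
`⟪∇P, ê_r⟫ + (1−γ)V_r + (γt − γ⟪c, ê_r⟫ + V_r)⟪DV ê_r, ê_r⟫ + (V_θ − γ⟪c, ê_θ⟫)⟪DV ê_θ, ê_r⟫ + (γ(s − c₂) + V_z)⟪DV e_z, ê_r⟫ = 0`
(inner product of the profile equation with `ê_r`, the transport field `γ(y−c) + V` expanded in the frame). [folklore] -/
theorem profile_eq_radial_frame {γ : ℝ} {c : EuclideanSpace ℝ (Fin 3)} {V : EuclideanSpace ℝ (Fin 3) → EuclideanSpace ℝ (Fin 3)}
    {P : EuclideanSpace ℝ (Fin 3) → ℝ} (hprof : IsSelfSimilarEulerProfile γ c V P) (s : ℝ) {t : ℝ} (ht : 0 < t) (θ : ℝ) :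
    ⟪gradient P (axisPt s t θ), eR (axisPt s t θ)⟫ + (1 - γ) * radialVelocity V (axisPt s t θ) +
      (γ * t - γ * ⟪c, eR (axisPt s t θ)⟫ + radialVelocity V (axisPt s t θ)) *
          ⟪fderiv ℝ V (axisPt s t θ) (eR (axisPt s t θ)), eR (axisPt s t θ)⟫ +
      (swirlVelocity V (axisPt s t θ) - γ * ⟪c, eTheta (axisPt s t θ)⟫) *
          ⟪fderiv ℝ V (axisPt s t θ) (eTheta (axisPt s t θ)), eR (axisPt s t θ)⟫ +
      (γ * (s - c 2) + axialVelocity V (axisPt s t θ)) *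
          ⟪fderiv ℝ V (axisPt s t θ) eZ, eR (axisPt s t θ)⟫ = 0 := by
  obtain ⟨hRR, -, hRT, hZR, -, -⟩ := frame_orthonormal_axisPt s ht θ
  have hy : cylRadius (axisPt s t θ) ≠ 0 := by rw [cylRadius_axisPt s ht.le θ]; exact ht.ne'
  set y := axisPt s t θ with hy_def
  set w := γ • (y - c) + V y with hw_def
  have hw' : w = (γ • y + V y) - γ • c := by rw [hw_def, smul_sub]; abel
  have hwr : ⟪w, eR y⟫ = γ * t - γ * ⟪c, eR y⟫ + radialVelocity V y := by
    rw [hw', inner_sub_left, (inner_transport_frame hy).2, inner_smul_left, hy_def, cylRadius_axisPt s ht.le θ]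
    simp only [RCLike.conj_to_real]; ring
  have hwθ : ⟪w, eTheta y⟫ = swirlVelocity V y - γ * ⟪c, eTheta y⟫ := by
    rw [hw', inner_sub_left, (inner_transport_frame hy).1, inner_smul_left]
    simp only [RCLike.conj_to_real]
  have hwz : ⟪w, eZ⟫ = γ * (s - c 2) + axialVelocity V y := by
    have e1 : ⟪w, eZ⟫ = w 2 := by simp [eZ, EuclideanSpace.inner_single_right]
    rw [e1, hw_def]
    simp only [PiLp.add_apply, PiLp.smul_apply, PiLp.sub_apply, smul_eq_mul, axialVelocity, hy_def,
      (axisPt_apply s t θ).2.2]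
  have hexp := frame_expand_axisPt s ht θ w
  rw [← hy_def] at hexp
  have hL : fderiv ℝ V y w = ⟪w, eR y⟫ • fderiv ℝ V y (eR y) + ⟪w, eTheta y⟫ • fderiv ℝ V y (eTheta y) +
      ⟪w, eZ⟫ • fderiv ℝ V y eZ := by
    conv_lhs => rw [hexp]
    simp only [map_add, map_smul]
  have h := congrArg (fun v => ⟪v, eR y⟫) (hprof.profile_eq y)
  rw [← hw_def, hL, hwr, hwθ, hwz] at h
  simp only [inner_add_left, inner_smul_left, inner_zero_left, RCLike.conj_to_real] at h
  have e : ⟪V y, eR y⟫ = radialVelocity V y := rfl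
  rw [e] at h
  linarith

/-- **INCOMPRESSIBILITY IN THE FRAME**: `⟪DV ê_r, ê_r⟫ + ⟪DV ê_θ, ê_θ⟫ + ⟪DV e_z, e_z⟫ = 0` at `y = axisPt s t θ`, `t > 0`. [folklore] -/
theorem frame_trace_eq_zero {γ : ℝ} {c : EuclideanSpace ℝ (Fin 3)} {V : EuclideanSpace ℝ (Fin 3) → EuclideanSpace ℝ (Fin 3)}
    {P : EuclideanSpace ℝ (Fin 3) → ℝ} (hprof : IsSelfSimilarEulerProfile γ c V P) (s : ℝ) {t : ℝ} (ht : 0 < t) (θ : ℝ) :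
    ⟪fderiv ℝ V (axisPt s t θ) (eR (axisPt s t θ)), eR (axisPt s t θ)⟫ +
        ⟪fderiv ℝ V (axisPt s t θ) (eTheta (axisPt s t θ)), eTheta (axisPt s t θ)⟫ +
        ⟪fderiv ℝ V (axisPt s t θ) eZ, eZ⟫ = 0 := by
  have h := divergence_eq_polarFrame V s ht θ
  rw [hprof.divFree (axisPt s t θ)] at h
  linarith

/-! ### The three conservative integrands, differentiated along the chart -/

/-- `r ∘ axisPt` has `t`-derivative `1` (`t > 0`). [folklore] -/
theorem hasDerivAt_cylRadius_axisPt_radius (s : ℝ) {t : ℝ} (ht : 0 < t) (θ : ℝ) :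
    HasDerivAt (fun t' => cylRadius (axisPt s t' θ)) 1 t := by
  refine (hasDerivAt_id t).congr_of_eventuallyEq ?_
  filter_upwards [lt_mem_nhds ht] with t' ht'
  rw [id, cylRadius_axisPt s ht'.le θ]

/-- **`D[(γr + V_r)V_r](y)[ê_r] = (γ + a_rr)V_r + (γt + V_r)a_rr`** at `y = axisPt s t θ`, `t > 0`, `a_rr = ⟪DV ê_r, ê_r⟫`. [folklore] -/
theorem fderiv_radialFlux_eR {γ : ℝ} {V : EuclideanSpace ℝ (Fin 3) → EuclideanSpace ℝ (Fin 3)} (s : ℝ) {t : ℝ} (ht : 0 < t)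
    (θ : ℝ) (hV : DifferentiableAt ℝ V (axisPt s t θ)) :
    fderiv ℝ (fun y => (γ * cylRadius y + radialVelocity V y) * radialVelocity V y) (axisPt s t θ) (eR (axisPt s t θ)) =
      (γ + ⟪fderiv ℝ V (axisPt s t θ) (eR (axisPt s t θ)), eR (axisPt s t θ)⟫) * radialVelocity V (axisPt s t θ) +
        (γ * t + radialVelocity V (axisPt s t θ)) * ⟪fderiv ℝ V (axisPt s t θ) (eR (axisPt s t θ)), eR (axisPt s t θ)⟫ := by
  have hy : cylRadius (axisPt s t θ) ≠ 0 := by rw [cylRadius_axisPt s ht.le θ]; exact ht.ne'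
  have hVr : DifferentiableAt ℝ (radialVelocity V) (axisPt s t θ) := differentiableAt_radialVelocity hy hV
  have hF : DifferentiableAt ℝ (fun y => (γ * cylRadius y + radialVelocity V y) * radialVelocity V y) (axisPt s t θ) :=
    (((hasFDerivAt_cylRadius hy).differentiableAt.const_mul γ).add hVr).mul hVr
  -- chain rule along `t' ↦ axisPt s t' θ`
  have h1 := hF.hasFDerivAt.comp_hasDerivAt t (hasDerivAt_axisPt_radius' s t θ)
  rw [← eR_axisPt s ht θ] at h1
  -- product rule along the chart
  have h2 : HasDerivAt (fun t' => (γ * cylRadius (axisPt s t' θ) + radialVelocity V (axisPt s t' θ)) * radialVelocity V (axisPt s t' θ))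
      ((γ * 1 + ⟪fderiv ℝ V (axisPt s t θ) (eR (axisPt s t θ)), eR (axisPt s t θ)⟫) * radialVelocity V (axisPt s t θ) +
        (γ * cylRadius (axisPt s t θ) + radialVelocity V (axisPt s t θ)) *
          ⟪fderiv ℝ V (axisPt s t θ) (eR (axisPt s t θ)), eR (axisPt s t θ)⟫) t :=
    (((hasDerivAt_cylRadius_axisPt_radius s ht θ).const_mul γ).add (hasDerivAt_radialVelocity_axisPt_radius s ht θ hV)).mul
      (hasDerivAt_radialVelocity_axisPt_radius s ht θ hV)
  have h3 := h1.unique h2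
  rw [h3, cylRadius_axisPt s ht.le θ, mul_one]

/-- **`D[(γ(y₂−c₂) + V_z)V_r](y)[e_z] = (γ + a_zz)V_r + (γ(s−c₂) + V_z)a_zr`** at `y = axisPt s t θ`, `t > 0`. [folklore] -/
theorem fderiv_axialFlux_eZ {γ : ℝ} {c : EuclideanSpace ℝ (Fin 3)} {V : EuclideanSpace ℝ (Fin 3) → EuclideanSpace ℝ (Fin 3)} (s : ℝ)
    {t : ℝ} (ht : 0 < t) (θ : ℝ) (hV : DifferentiableAt ℝ V (axisPt s t θ)) :
    fderiv ℝ (fun y => (γ * (y 2 - c 2) + axialVelocity V y) * radialVelocity V y) (axisPt s t θ) eZ =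
      (γ + ⟪fderiv ℝ V (axisPt s t θ) eZ, eZ⟫) * radialVelocity V (axisPt s t θ) +
        (γ * (s - c 2) + axialVelocity V (axisPt s t θ)) * ⟪fderiv ℝ V (axisPt s t θ) eZ, eR (axisPt s t θ)⟫ := by
  have hy : cylRadius (axisPt s t θ) ≠ 0 := by rw [cylRadius_axisPt s ht.le θ]; exact ht.ne'
  have hVr : DifferentiableAt ℝ (radialVelocity V) (axisPt s t θ) := differentiableAt_radialVelocity hy hV
  have hVz : DifferentiableAt ℝ (axialVelocity V) (axisPt s t θ) := differentiableAt_axialVelocity hV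
  have hc2 : DifferentiableAt ℝ (fun y : EuclideanSpace ℝ (Fin 3) => y 2 - c 2) (axisPt s t θ) :=
    (hasFDerivAt_coord 2 _).differentiableAt.sub_const _
  have hF : DifferentiableAt ℝ (fun y => (γ * (y 2 - c 2) + axialVelocity V y) * radialVelocity V y) (axisPt s t θ) :=
    ((hc2.const_mul γ).add hVz).mul hVr
  have h1 := hF.hasFDerivAt.comp_hasDerivAt s (hasDerivAt_axisPt_height s t θ)
  have hs : HasDerivAt (fun s' => (axisPt s' t θ) 2 - c 2) 1 s := by
    have e : (fun s' => (axisPt s' t θ) 2 - c 2) = fun s' => s' - c 2 := by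
      funext s'; rw [(axisPt_apply s' t θ).2.2]
    rw [e]
    exact (hasDerivAt_id s).sub_const _
  have h2 : HasDerivAt (fun s' => (γ * ((axisPt s' t θ) 2 - c 2) + axialVelocity V (axisPt s' t θ)) * radialVelocity V (axisPt s' t θ))
      ((γ * 1 + ⟪fderiv ℝ V (axisPt s t θ) eZ, eZ⟫) * radialVelocity V (axisPt s t θ) +
        (γ * ((axisPt s t θ) 2 - c 2) + axialVelocity V (axisPt s t θ)) * ⟪fderiv ℝ V (axisPt s t θ) eZ, eR (axisPt s t θ)⟫) s :=
    (((hs.const_mul γ).add (hasDerivAt_axialVelocity_axisPt_height s t θ hV)).mul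
      (hasDerivAt_radialVelocity_axisPt_height s ht θ hV))
  have h3 := h1.unique h2
  rw [h3, (axisPt_apply s t θ).2.2, mul_one]

/-- **`D[−(c₀ ê_r,₀ + c₁ ê_r,₁) V_z](y)[e_z] = −⟪c, ê_r⟫ a_zz`** at `y = axisPt s t θ`, `t > 0` (the `offsetTerm` integrand; the frame
does not turn along `s`). [folklore] -/
theorem fderiv_offsetFlux_eZ {c : EuclideanSpace ℝ (Fin 3)} {V : EuclideanSpace ℝ (Fin 3) → EuclideanSpace ℝ (Fin 3)} (s : ℝ)
    {t : ℝ} (ht : 0 < t) (θ : ℝ) (hV : DifferentiableAt ℝ V (axisPt s t θ)) :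
    fderiv ℝ (fun y => (-(c 0 * eR y 0 + c 1 * eR y 1)) * axialVelocity V y) (axisPt s t θ) eZ =
      -⟪c, eR (axisPt s t θ)⟫ * ⟪fderiv ℝ V (axisPt s t θ) eZ, eZ⟫ := by
  have hy : cylRadius (axisPt s t θ) ≠ 0 := by rw [cylRadius_axisPt s ht.le θ]; exact ht.ne'
  have hVz : DifferentiableAt ℝ (axialVelocity V) (axisPt s t θ) := differentiableAt_axialVelocity hV
  have he0 : DifferentiableAt ℝ (fun y => eR y 0) (axisPt s t θ) :=
    (hasFDerivAt_coord 0 _).differentiableAt.comp (axisPt s t θ) (differentiableAt_eR hy)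
  have he1 : DifferentiableAt ℝ (fun y => eR y 1) (axisPt s t θ) :=
    (hasFDerivAt_coord 1 _).differentiableAt.comp (axisPt s t θ) (differentiableAt_eR hy)
  have hF : DifferentiableAt ℝ (fun y => (-(c 0 * eR y 0 + c 1 * eR y 1)) * axialVelocity V y) (axisPt s t θ) :=
    ((he0.const_mul (c 0)).add (he1.const_mul (c 1))).neg.mul hVz
  have h1 := hF.hasFDerivAt.comp_hasDerivAt s (hasDerivAt_axisPt_height s t θ)
  have h2 : HasDerivAt (fun s' => (-(c 0 * eR (axisPt s' t θ) 0 + c 1 * eR (axisPt s' t θ) 1)) * axialVelocity V (axisPt s' t θ))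
      ((-(c 0 * eR (axisPt s t θ) 0 + c 1 * eR (axisPt s t θ) 1)) * ⟪fderiv ℝ V (axisPt s t θ) eZ, eZ⟫) s := by
    refine ((hasDerivAt_axialVelocity_axisPt_height s t θ hV).const_mul _).congr_of_eventuallyEq
      (Eventually.of_forall fun s' => ?_)
    simp only [eR_axisPt_height s' s ht θ]
  have h3 := h1.unique h2
  rw [h3, inner_eR_eq_components]

/-! ### The `θ`-bracket -/

/-- `∂_θ ⟪c, ê_r⟫ = ⟪c, ê_θ⟫` along the circle (`t > 0`). [folklore] -/
theorem hasDerivAt_inner_eR_axisPt (c : EuclideanSpace ℝ (Fin 3)) (s : ℝ) {t : ℝ} (ht : 0 < t) (θ : ℝ) :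
    HasDerivAt (fun θ' => ⟪c, eR (axisPt s t θ')⟫) ⟪c, eTheta (axisPt s t θ)⟫ θ := by
  have h := (hasDerivAt_const θ c).inner ℝ (hasDerivAt_eR_axisPt s ht θ)
  simpa using h

/-- `∂_θ ⟪c, ê_θ⟫ = −⟪c, ê_r⟫` along the circle (`t > 0`). [folklore] -/
theorem hasDerivAt_inner_eTheta_axisPt (c : EuclideanSpace ℝ (Fin 3)) (s : ℝ) {t : ℝ} (ht : 0 < t) (θ : ℝ) :
    HasDerivAt (fun θ' => ⟪c, eTheta (axisPt s t θ')⟫) (-⟪c, eR (axisPt s t θ)⟫) θ := by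
  have h := (hasDerivAt_const θ c).inner ℝ (hasDerivAt_eTheta_axisPt s ht θ)
  simpa [inner_neg_right] using h

/-- **THE θ-BRACKET**: along the circle (`t > 0`, `y = axisPt s t θ`, `V` differentiable at `y`),
`∂_θ [V_θ V_r + γ(⟪c,ê_r⟫ V_θ − ⟪c,ê_θ⟫ V_r)] = t(a_θθ V_r + a_θr V_θ) − V_r² + V_θ² + γt(⟪c,ê_r⟫ a_θθ − ⟪c,ê_θ⟫ a_θr)`,
`a_θθ = ⟪DV ê_θ, ê_θ⟫`, `a_θr = ⟪DV ê_θ, ê_r⟫`. [folklore] -/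
theorem hasDerivAt_thetaBracket {γ : ℝ} {c : EuclideanSpace ℝ (Fin 3)} {V : EuclideanSpace ℝ (Fin 3) → EuclideanSpace ℝ (Fin 3)}
    (s : ℝ) {t : ℝ} (ht : 0 < t) (θ : ℝ) (hV : DifferentiableAt ℝ V (axisPt s t θ)) :
    HasDerivAt (fun θ' => swirlVelocity V (axisPt s t θ') * radialVelocity V (axisPt s t θ') +
        γ * (⟪c, eR (axisPt s t θ')⟫ * swirlVelocity V (axisPt s t θ') - ⟪c, eTheta (axisPt s t θ')⟫ * radialVelocity V (axisPt s t θ')))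
      (t * (⟪fderiv ℝ V (axisPt s t θ) (eTheta (axisPt s t θ)), eTheta (axisPt s t θ)⟫ * radialVelocity V (axisPt s t θ) +
            ⟪fderiv ℝ V (axisPt s t θ) (eTheta (axisPt s t θ)), eR (axisPt s t θ)⟫ * swirlVelocity V (axisPt s t θ)) -
          radialVelocity V (axisPt s t θ) ^ 2 + swirlVelocity V (axisPt s t θ) ^ 2 +
        γ * t * (⟪c, eR (axisPt s t θ)⟫ * ⟪fderiv ℝ V (axisPt s t θ) (eTheta (axisPt s t θ)), eTheta (axisPt s t θ)⟫ -
          ⟪c, eTheta (axisPt s t θ)⟫ * ⟪fderiv ℝ V (axisPt s t θ) (eTheta (axisPt s t θ)), eR (axisPt s t θ)⟫)) θ := by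
  have hVr := hasDerivAt_radialVelocity_axisPt s ht θ hV
  have hVθ := hasDerivAt_swirlVelocity_axisPt s ht θ hV
  have hcr := hasDerivAt_inner_eR_axisPt c s ht θ
  have hcθ := hasDerivAt_inner_eTheta_axisPt c s ht θ
  refine ((hVθ.mul hVr).add (((hcr.mul hVθ).sub (hcθ.mul hVr)).const_mul γ)).congr_deriv ?_
  ring

/-! ### AX-2, pointwise and averaged -/

/-- **THE RADIAL LAW, CONSERVATIVE FORM, AT A CIRCLE POINT** (`t > 0`, `y = axisPt s t θ`):
`⟪∇P, ê_r⟫ + (1−3γ)V_r + D[(γr+V_r)V_r][ê_r] + D[(γ(y₂−c₂)+V_z)V_r][e_z] − γ·D[−(c₀ê_r,₀ + c₁ê_r,₁)V_z][e_z]`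
`+ (a_θθ V_r + a_θr V_θ) + γ(⟪c,ê_r⟫ a_θθ − ⟪c,ê_θ⟫ a_θr) = 0`
(`= profile_eq_radial_frame + (V_r + γ⟪c,ê_r⟫)·frame_trace_eq_zero`). [folklore] -/
theorem radialLaw_pointwise {γ : ℝ} {c : EuclideanSpace ℝ (Fin 3)} {V : EuclideanSpace ℝ (Fin 3) → EuclideanSpace ℝ (Fin 3)}
    {P : EuclideanSpace ℝ (Fin 3) → ℝ} (hprof : IsSelfSimilarEulerProfile γ c V P) (s : ℝ) {t : ℝ} (ht : 0 < t) (θ : ℝ) :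
    ⟪gradient P (axisPt s t θ), eR (axisPt s t θ)⟫ + (1 - 3 * γ) * radialVelocity V (axisPt s t θ) +
      fderiv ℝ (fun y => (γ * cylRadius y + radialVelocity V y) * radialVelocity V y) (axisPt s t θ) (eR (axisPt s t θ)) +
      fderiv ℝ (fun y => (γ * (y 2 - c 2) + axialVelocity V y) * radialVelocity V y) (axisPt s t θ) eZ -
      γ * fderiv ℝ (fun y => (-(c 0 * eR y 0 + c 1 * eR y 1)) * axialVelocity V y) (axisPt s t θ) eZ +
      (⟪fderiv ℝ V (axisPt s t θ) (eTheta (axisPt s t θ)), eTheta (axisPt s t θ)⟫ * radialVelocity V (axisPt s t θ) +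
        ⟪fderiv ℝ V (axisPt s t θ) (eTheta (axisPt s t θ)), eR (axisPt s t θ)⟫ * swirlVelocity V (axisPt s t θ)) +
      γ * (⟪c, eR (axisPt s t θ)⟫ * ⟪fderiv ℝ V (axisPt s t θ) (eTheta (axisPt s t θ)), eTheta (axisPt s t θ)⟫ -
        ⟪c, eTheta (axisPt s t θ)⟫ * ⟪fderiv ℝ V (axisPt s t θ) (eTheta (axisPt s t θ)), eR (axisPt s t θ)⟫) = 0 := by
  have hV : DifferentiableAt ℝ V (axisPt s t θ) := (hprof.contDiff_velocity.differentiable (by norm_num)) _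
  have hPW1 := profile_eq_radial_frame hprof s ht θ
  have hDIV := frame_trace_eq_zero hprof s ht θ
  rw [fderiv_radialFlux_eR s ht θ hV, fderiv_axialFlux_eZ s ht θ hV, fderiv_offsetFlux_eZ s ht θ hV]
  linear_combination hPW1 + (radialVelocity V (axisPt s t θ) + γ * ⟪c, eR (axisPt s t θ)⟫) * hDIV

/-- **AX-2 — THE CIRCLE-AVERAGED RADIAL LAW (general centre `c`)**: for a `C²` self-similar Euler profile and every circle of radius
`t > 0` at height `s` around the `e_z`-axis,
`circleAvg (⟪∇P, ê_r⟫ + (1−3γ)V_r + D[(γr+V_r)V_r][ê_r] + D[(γ(y₂−c₂)+V_z)V_r][e_z] − γ·D[−(c₀ê_r,₀+c₁ê_r,₁)V_z][e_z] + (V_r² − V_θ²)/r) s t = 0`: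
the `θ`-bracket of `radialLaw_pointwise` is `(1/t)(∂_θ[…] + V_r² − V_θ²)` and the `θ`-derivative of a `2π`-periodic function
averages to zero. [folklore] -/
theorem radialLaw_circleAvg {γ : ℝ} {c : EuclideanSpace ℝ (Fin 3)} {V : EuclideanSpace ℝ (Fin 3) → EuclideanSpace ℝ (Fin 3)}
    {P : EuclideanSpace ℝ (Fin 3) → ℝ} (hprof : IsSelfSimilarEulerProfile γ c V P) (s : ℝ) {t : ℝ} (ht : 0 < t) :
    circleAvg (fun y => ⟪gradient P y, eR y⟫ + (1 - 3 * γ) * radialVelocity V y +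
        fderiv ℝ (fun y => (γ * cylRadius y + radialVelocity V y) * radialVelocity V y) y (eR y) +
        fderiv ℝ (fun y => (γ * (y 2 - c 2) + axialVelocity V y) * radialVelocity V y) y eZ -
        γ * fderiv ℝ (fun y => (-(c 0 * eR y 0 + c 1 * eR y 1)) * axialVelocity V y) y eZ +
        (radialVelocity V y ^ 2 - swirlVelocity V y ^ 2) / cylRadius y) s t = 0 := by
  have hVd : ∀ θ, DifferentiableAt ℝ V (axisPt s t θ) := fun θ => (hprof.contDiff_velocity.differentiable (by norm_num)) _
  -- notation for the bracket derivative
  set G' : ℝ → ℝ := fun θ =>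
    t * (⟪fderiv ℝ V (axisPt s t θ) (eTheta (axisPt s t θ)), eTheta (axisPt s t θ)⟫ * radialVelocity V (axisPt s t θ) +
          ⟪fderiv ℝ V (axisPt s t θ) (eTheta (axisPt s t θ)), eR (axisPt s t θ)⟫ * swirlVelocity V (axisPt s t θ)) -
        radialVelocity V (axisPt s t θ) ^ 2 + swirlVelocity V (axisPt s t θ) ^ 2 +
      γ * t * (⟪c, eR (axisPt s t θ)⟫ * ⟪fderiv ℝ V (axisPt s t θ) (eTheta (axisPt s t θ)), eTheta (axisPt s t θ)⟫ -
        ⟪c, eTheta (axisPt s t θ)⟫ * ⟪fderiv ℝ V (axisPt s t θ) (eTheta (axisPt s t θ)), eR (axisPt s t θ)⟫) with hG'_def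
  -- the integrand is `-(1/t) G'` pointwise
  have hpt : ∀ θ, ⟪gradient P (axisPt s t θ), eR (axisPt s t θ)⟫ + (1 - 3 * γ) * radialVelocity V (axisPt s t θ) +
      fderiv ℝ (fun y => (γ * cylRadius y + radialVelocity V y) * radialVelocity V y) (axisPt s t θ) (eR (axisPt s t θ)) +
      fderiv ℝ (fun y => (γ * (y 2 - c 2) + axialVelocity V y) * radialVelocity V y) (axisPt s t θ) eZ -
      γ * fderiv ℝ (fun y => (-(c 0 * eR y 0 + c 1 * eR y 1)) * axialVelocity V y) (axisPt s t θ) eZ +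
      (radialVelocity V (axisPt s t θ) ^ 2 - swirlVelocity V (axisPt s t θ) ^ 2) / cylRadius (axisPt s t θ) =
        -(1 / t) * G' θ := by
    intro θ
    have h := radialLaw_pointwise hprof s ht θ
    have e : -(1 / t) * G' θ =
        -(⟪fderiv ℝ V (axisPt s t θ) (eTheta (axisPt s t θ)), eTheta (axisPt s t θ)⟫ * radialVelocity V (axisPt s t θ) +
            ⟪fderiv ℝ V (axisPt s t θ) (eTheta (axisPt s t θ)), eR (axisPt s t θ)⟫ * swirlVelocity V (axisPt s t θ)) -
          γ * (⟪c, eR (axisPt s t θ)⟫ * ⟪fderiv ℝ V (axisPt s t θ) (eTheta (axisPt s t θ)), eTheta (axisPt s t θ)⟫ -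
            ⟪c, eTheta (axisPt s t θ)⟫ * ⟪fderiv ℝ V (axisPt s t θ) (eTheta (axisPt s t θ)), eR (axisPt s t θ)⟫) +
          (radialVelocity V (axisPt s t θ) ^ 2 - swirlVelocity V (axisPt s t θ) ^ 2) / t := by
      rw [hG'_def]
      field_simp
      ring
    rw [cylRadius_axisPt s ht.le θ, e]
    linear_combination h
  -- continuity of `G'` in `θ`
  have hL : Continuous fun θ => fderiv ℝ V (axisPt s t θ) :=
    (hprof.contDiff_velocity.continuous_fderiv (by norm_num)).comp (continuous_axisPt_angle s t)
  have hR : Continuous fun θ => eR (axisPt s t θ) :=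
    continuous_iff_continuousAt.2 fun θ => (hasDerivAt_eR_axisPt s ht θ).continuousAt
  have hT : Continuous fun θ => eTheta (axisPt s t θ) :=
    continuous_iff_continuousAt.2 fun θ => (hasDerivAt_eTheta_axisPt s ht θ).continuousAt
  have hVr : Continuous fun θ => radialVelocity V (axisPt s t θ) :=
    continuous_iff_continuousAt.2 fun θ => (hasDerivAt_radialVelocity_axisPt s ht θ (hVd θ)).continuousAt
  have hVθ : Continuous fun θ => swirlVelocity V (axisPt s t θ) :=
    continuous_iff_continuousAt.2 fun θ => (hasDerivAt_swirlVelocity_axisPt s ht θ (hVd θ)).continuousAt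
  have hcr : Continuous fun θ => ⟪c, eR (axisPt s t θ)⟫ :=
    continuous_iff_continuousAt.2 fun θ => (hasDerivAt_inner_eR_axisPt c s ht θ).continuousAt
  have hcθ : Continuous fun θ => ⟪c, eTheta (axisPt s t θ)⟫ :=
    continuous_iff_continuousAt.2 fun θ => (hasDerivAt_inner_eTheta_axisPt c s ht θ).continuousAt
  have haTT : Continuous fun θ => ⟪fderiv ℝ V (axisPt s t θ) (eTheta (axisPt s t θ)), eTheta (axisPt s t θ)⟫ :=
    (hL.clm_apply hT).inner hT
  have haTR : Continuous fun θ => ⟪fderiv ℝ V (axisPt s t θ) (eTheta (axisPt s t θ)), eR (axisPt s t θ)⟫ :=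
    (hL.clm_apply hT).inner hR
  have hG'c : Continuous G' := by
    rw [hG'_def]
    exact (((continuous_const.mul ((haTT.mul hVr).add (haTR.mul hVθ))).sub (hVr.pow 2)).add (hVθ.pow 2)).add
      (continuous_const.mul ((hcr.mul haTT).sub (hcθ.mul haTR)))
  -- FTC over one period
  have hFTC : ∫ θ in (0 : ℝ)..(2 * Real.pi), G' θ = 0 := by
    have hder : ∀ θ ∈ uIcc (0 : ℝ) (2 * Real.pi), HasDerivAt (fun θ' => swirlVelocity V (axisPt s t θ') * radialVelocity V (axisPt s t θ') +
        γ * (⟪c, eR (axisPt s t θ')⟫ * swirlVelocity V (axisPt s t θ') - ⟪c, eTheta (axisPt s t θ')⟫ * radialVelocity V (axisPt s t θ')))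
        (G' θ) θ := fun θ _ => by
      rw [hG'_def]
      exact hasDerivAt_thetaBracket s ht θ (hVd θ)
    rw [integral_eq_sub_of_hasDerivAt hder (hG'c.intervalIntegrable _ _)]
    have hp : axisPt s t (2 * Real.pi) = axisPt s t 0 := by
      have := axisPt_add_two_pi s t 0
      rwa [zero_add] at this
    rw [hp]
    ring
  -- assemble
  unfold circleAvg
  rw [intervalIntegral.integral_congr (g := fun θ => -(1 / t) * G' θ) (fun θ _ => hpt θ), intervalIntegral.integral_const_mul,
    hFTC, mul_zero, mul_zero]

/-- **`∂_t circleAvg P s t = circleAvg ⟪∇P, ê_r⟫ s t`** for `P ∈ C¹`, `t > 0` (the left side of AX-2 as a `t`-derivative; input of AX-3).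
[folklore] -/
theorem hasDerivAt_circleAvg_pressure_radius {P : EuclideanSpace ℝ (Fin 3) → ℝ} (hP : ContDiff ℝ 1 P) (s : ℝ) {t : ℝ} (ht : 0 < t) :
    HasDerivAt (fun t' => circleAvg P s t') (circleAvg (fun y => ⟪gradient P y, eR y⟫) s t) t := by
  have h := hasDerivAt_circleAvg_radius hP s ht
  have e : (fun y => ⟪gradient P y, eR y⟫) = fun y => fderiv ℝ P y (eR y) := by
    funext y; rw [gradient, InnerProductSpace.toDual_symm_apply]
  rw [e]
  exact h

end Summit.NavierStokesRegularity.NavierStokesRegularity.Theorems.PowerGaugeEulerLiouville.HoopCore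

end
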